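import Literature.MathematicalPhysics.QuantumFieldTheory.Balaban1983to89.Node00.Record12CarriersB13Family
import Summits.QuantumFields.YangMills.Theorems.BalabanUVNodesN10AtRecord11B13

/-!
# BalabanUVNodes ∕ N10 IN THE HISTORY-INDEXED FAMILY CURRENCY AT NODE 00's [B13] GROUP OF RECORD — THE JUNCTION: [Balaban1988RG2Cluster] Lemmas 1–2 knit
# MEMBER-WISE from their located inputs at `Node00.WtOfRecord θ (lamF k v)` over a family `lamF : Node00.ResidB13Fam θ` with ONE letter record, Lemma 3 the
# member-wise located FLAG (resp. at LEVEL T from (2.26) per term at the NATURAL RATE `γ₂ε₁²∕g_k²` with ONE numerics bundle at the box-minimal rate)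
# (Track A, DAG node N10 [B13]; strategy s2 «by-name knit at the record»; seat `pub-ymgap-dag-n10-d` g4; consumer junction of `Node00/Record12CarriersB13Family` p476387)

HONEST FRAMING.  Count-neutral kernel bookkeeping over LANDED modules: NODE 00's family currency `Node00/Record12CarriersB13Family` (def-B13 g3, p476387:
`ResidB13Fam θ`, `B13FamLeafOfRecord θ γ₀ lamF c`, the member bridge `b13FamLeafOfRecord_of_forall_b13LeafOfRecord`, the displayed index law
`ResidB13Fam.IsStepIndexed` with `IsStepIndexed.g_ne_zero`), this seat's Stage-3 junction `…N10AtRecord11B13` (p459088: `b13LeafOfRecord_of_located`,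
`b13LeafOfRecord_of_located_termwise` — `B13NodeTorusTermwise.lemma12_twoTorus` ∕ `b13Leaf_twoTorus_termwise` at the objects of record with every
identification binder discharged by `CarriersB13`'s faces) and dag-p2's family socket `B13NodeTorusFamily` (p412…: `rate_min_le_rate`; `termwise226_anti` of
`B13Lemma3TorusSocket`).  N10 is NOT discharged: the located per-term inputs of Lemmas 1–2 (and, at LEVEL T, (2.26) per term + the numbers; else the Lemma-3
FLAG) are HYPOTHESES ABOUT THE HIDDEN FAMILY `lamF` — print's located input displayed member-wise, not proved — and NODE A's content ((2.26) ∕ Lemma 3: [13]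
Thm 3.10∕3.12 for Bałaban's kernels) is owned elsewhere (N06 s4, dag-n10-c's walks currency).  CONTENTFULNESS (def-B13 §3, cited, not re-derived): in the
∃-currency over `lamF` the family leaf is junk through lever (i) = THE TERMS (`Node00.exists_residB13Fam_b13FamLeafOfRecord_of_nonneg`: the constant ZERO
family passes); content = the term tower OF RECORD (XL, absent) or THIS ∀-lawful ∕ termwise currency, which quantifies over the family and asks print's located
input of EVERY member.  Nothing of Bałaban's is asserted; no node count moves; one finite four-torus programme at fixed ε per run; nothing continuum ∕ ℝ⁴ ∕ OS ∕
mass-gap ∕ Clay.  0 `sorry`, 0 `def`, standard axioms.  Filed `--supports` K1′ «StabilityBAtRecordR12e» (stmt-QuantumFields-19903) of route «BalabanUVNodes».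

WHY THE FAMILY (def-B13's TERM-TOWER CENSUS §4, N09's (iv⁵) `B12NodeKnit.b12_main_of_up_frameOf_of_b13Family_eHolo`): [I]'s Theorem 3 consumes Lemmas 1–3 at
EVERY step `k` of a run and every coupling history `v = (g_0, …, g_k) ∈ ]0, γ₀]^{k+1}` with ONE constants record — the DAG slot is one step datum per run, the
printed Lemma is the family.  Print's constants `K, K′` ([I] (3.54), (3.17)), `ϑ`, `R, K₂, m₂` ((1.38)–(1.42)), the thresholds R7–R9 and the numerics of Lemma 3
are «absolute constants», uniform in `k`; the ONLY history-dependent letter is (2.26)'s |P|-rate `a = γ₂ε₁²∕g_k²`, antitone, checked ONCE at the box minimum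
`γ₂ε₁²∕γ₀²` (p. 18 «(1∕20)γ₂ε₁²∕g_k² ≧ (1∕20)γ₂ε₁²∕γ²»).  This file makes exactly that a kernel statement at the group of record: UNIFORM constants and
thresholds on the ONE residual letter record `c₀` (the members' letter field, `(lamF k v).c = c₀` on the box — the conjunct def-B13's honesty theorem displays),
MEMBER-WISE per-term inputs on the box, Lemma 2's `g_k ≠ 0` DISCHARGED by the index law (`0 < g_k` in the box).

WHAT THIS FILE PROVES.  §1 `b13FamLeafOfRecord_of_located` (Lemmas 1–2 member-wise from located inputs, Lemma 3 the member-wise FLAG ⟹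
`B13FamLeafOfRecord θ γ₀ lamF {c₀ with L := θ.ℓ₆ + 1}`); `b13FamLeafOfRecord_of_located_termwise` (LEVEL T: all three lemmas from located inputs, (2.26) per term
per member at the natural rate, ONE `Lemma3Numerics` bundle at the box-minimal rate, the displayed bond-fineness law, `8 ≤ L`).  The Stage-12 reading at the
letters of record (`c₀ := Node00.c13OfRecord₁₂ θ c`, `γ₀ := θ.γ`, `hδ1` discharged) is the companion module `…N10AtRecord12B13Family`.
-/

noncomputable section

namespace Summit.QuantumFields.YangMills.BalabanUVNodes.N10AtRecord11B13Family

open Literature.MathematicalPhysics.QuantumFieldTheory.Balaban1983to89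
open Literature.MathematicalPhysics.QuantumFieldTheory.Balaban1983to89.T4Continuum
open Literature.MathematicalPhysics.QuantumFieldTheory.Balaban1983to89.Node00
open Literature.MathematicalPhysics.QuantumFieldTheory.Balaban1983to89.B13Lemma3Torus (TwoTorusStep)
open Literature.MathematicalPhysics.QuantumFieldTheory.Balaban1983to89.B13Lemma3TorusSocket (TermDomination Termwise226 Lemma3Numerics termwise226_anti)
open Metric
open Literature.MathematicalPhysics.QuantumFieldTheory.Balaban1983to89.B16Absorption (pbox)
open Literature.MathematicalPhysics.QuantumFieldTheory.Balaban1983to89.TreeLengthTorus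
open Literature.MathematicalPhysics.QuantumFieldTheory.Balaban1983to89.TreeLengthTorusTransfer (tcoarse)
open Literature.MathematicalPhysics.QuantumFieldTheory.Balaban1983to89.B12TreeDecay (kappa₀ K₀)
open Literature.MathematicalPhysics.QuantumFieldTheory.Balaban1983to89.B13PkScaling (Qop scaled)
open Literature.MathematicalPhysics.QuantumFieldTheory.Balaban1983to89.B13NodeTorusFamily (rate_min_le_rate)
open Summit.QuantumFields.YangMills.BalabanUVNodes.N10AtRecord11B13 (b13LeafOfRecord_of_located b13LeafOfRecord_of_located_termwise)

/-! ## §1. THE JUNCTION IN THE FAMILY CURRENCY AT THE GROUP OF RECORD (Stage 3′, any box `γ₀`, one residual letter record `c₀`) -/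

section Family

variable (θ : Stage3Params) {γ₀ : ℝ} (lamF : ResidB13Fam θ) (c₀ : B13.Consts)

set_option maxSynthPendingDepth 3 in
/-- **THE [B13] FAMILY LEAF AT NODE 00's GROUP OF RECORD — LEMMAS 1–2 KNIT MEMBER-WISE FROM THEIR LOCATED PER-TERM INPUTS, LEMMA 3 THE MEMBER-WISE LOCATED FLAG.**
At Stage-3 parameters `θ` (block size `L = θ.ℓ₆ + 1`), a history-indexed residual [B13] term layer `lamF : ResidB13Fam θ` (one layer per step `k` and coupling
history `v ∈ ℝ^{k+1}`), a box `]0, γ₀]^{k+1}` and ONE residual letter record `c₀`: IF on the box every member's letter field IS `c₀` (`hc`, def-B13's displayed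
conjunct) and the family carries the displayed index law (`hidx : IsStepIndexed γ₀ lamF` — step index `k`, running coupling `g_k = v_k`; so Lemma 2's `g_k ≠ 0` is
DISCHARGED member-wise by `IsStepIndexed.g_ne_zero`), and every member in the box satisfies print's located input of LEMMA 1 (pp. 7–9: ≥ 12 fine cubes per direction,
[I]'s block geometry of the member's (1.33) index families with its distance reading `dist k v`, per-term analyticity on (1.34), per-term (1.24)∕(1.30) `h124 h130`
BY REFERENCE to [I] (3.54), (3.17), [15] Prop. 4, [13] (3.108)) and of LEMMA 2 (pp. 10–11: curvature terms, `‖e_{Y,b}‖ ≤ 1`, plaquette data (1.38)–(1.42),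
floor, per-term analyticity, gauge invariance by assertion) with print's k-UNIFORM O(1) constants `K K' ϑ R K₂ m₂` and k-UNIFORM thresholds R7–R9 ∕ choice of
`C₁, C₂, q` with headroom `(1 − ϑ)` on `c₀`, and LEMMA 3 (p. 20) holds member-wise as THE FLAG `h3` (NODE A's content, displayed, NOT proved here) — THEN the
family leaf of record `B13FamLeafOfRecord θ γ₀ lamF {c₀ with L := θ.ℓ₆ + 1}` (Lemma 1 ∧ Lemma 2 ∧ Lemma 3 AS PRINTED for every member's step data of record with the
ONE constants record).  Proof: one `b13LeafOfRecord_of_located` per member (every identification binder already discharged there by `CarriersB13`'s faces) and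
def-B13's `b13FamLeafOfRecord_of_forall_b13LeafOfRecord`.  Count-neutral: the inputs are hypotheses about the HIDDEN family; nothing of Bałaban's is asserted.
[cite: Balaban1988RG2Cluster, Lemma 1 p.9, Lemma 2 p.11, Lemma 3 p.20; Balaban1987RG1, Thm 3 p.264 (Lemmas 1–3 consumed at every step, last coupling variable)] -/
theorem b13FamLeafOfRecord_of_located
    (hc : ∀ k v, v ∈ FlowStep.Box γ₀ k → (lamF k v).c = c₀) (hidx : ResidB13Fam.IsStepIndexed γ₀ lamF)
    (hN12 : ∀ k v, v ∈ FlowStep.Box γ₀ k → 12 ≤ (θ.ℓ₆ + 1) * ((lamF k v).n + 1))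
    -- (1) LEMMA 1: [I]'s block geometry of the (1.33) index families of every member in the box
    (dist : (k : ℕ) → (v : Fin (k + 1) → ℝ) → TDom 4 ((θ.ℓ₆ + 1) * ((lamF k v).n + 1)) → TPt 4 ((θ.ℓ₆ + 1) * ((lamF k v).n + 1)) → (j : ℕ) →
      TPt 4 ((θ.ℓ₆ + 1) ^ ((lamF k v).k - j) * ((θ.ℓ₆ + 1) * ((lamF k v).n + 1))) → ℝ) {K K' : ℝ}
    (hS0Y : ∀ k v, v ∈ FlowStep.Box γ₀ k → ∀ Y, ∀ a ∈ (lamF k v).S0 Y,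
      (pbox (fun i => natLift a i - (5 : ℕ)) (fun i => natLift a i + 1 + (5 : ℕ))).image (proj ((θ.ℓ₆ + 1) * ((lamF k v).n + 1))) ⊆ Y.1)
    (hFsub : ∀ k v, v ∈ FlowStep.Box γ₀ k → ∀ Y a, (lamF k v).F Y a ⊆
      (pbox (fun i => natLift a i - (5 : ℕ)) (fun i => natLift a i + 1 + (5 : ℕ))).image (proj ((θ.ℓ₆ + 1) * ((lamF k v).n + 1))) \
        (pbox (fun i => natLift a i - (4 : ℕ)) (fun i => natLift a i + 1 + (4 : ℕ))).image (proj ((θ.ℓ₆ + 1) * ((lamF k v).n + 1))))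
    (hSq : ∀ k v, v ∈ FlowStep.Box γ₀ k → ∀ Y, ∀ a ∈ (lamF k v).S0 Y, ∀ j, (lamF k v).Sq Y a j ⊆
      (Finset.univ : Finset (TPt 4 ((θ.ℓ₆ + 1) ^ ((lamF k v).k - j) * ((θ.ℓ₆ + 1) * ((lamF k v).n + 1))))).filter
        (fun q => tcoarse ((θ.ℓ₆ + 1) ^ ((lamF k v).k - j)) ((θ.ℓ₆ + 1) * ((lamF k v).n + 1)) q ∈
          (pbox (fun i => natLift a i - (2 : ℕ)) (fun i => natLift a i + 1 + (2 : ℕ))).image (proj ((θ.ℓ₆ + 1) * ((lamF k v).n + 1)))))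
    (hScY : ∀ k v, v ∈ FlowStep.Box γ₀ k → ∀ Y, (lamF k v).Sc Y ⊆ Y.1)
    (hdist0 : ∀ k v, v ∈ FlowStep.Box γ₀ k → ∀ Y a j q, 0 ≤ c₀.δ₀ * dist k v Y a j q)
    (hdist : ∀ k v, v ∈ FlowStep.Box γ₀ k → ∀ Y a j (n : ℕ) q,
      q ∉ (pbox (fun i => (((θ.ℓ₆ + 1) ^ ((lamF k v).k - j) : ℕ) : ℤ) * natLift a i - (n + 1 : ℕ))
        (fun i => (((θ.ℓ₆ + 1) ^ ((lamF k v).k - j) : ℕ) : ℤ) * natLift a i + 2 * (((θ.ℓ₆ + 1) ^ ((lamF k v).k - j) : ℕ) : ℤ) - 1 + (n + 1 : ℕ))).image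
          (proj ((θ.ℓ₆ + 1) ^ ((lamF k v).k - j) * ((θ.ℓ₆ + 1) * ((lamF k v).n + 1)))) →
        c₀.δ₀ * c₀.M * ((n : ℝ) + 1) ≤ c₀.δ₀ * dist k v Y a j q)
    (hSX : ∀ k v, v ∈ FlowStep.Box γ₀ k → ∀ Y a j q,
      (lamF k v).SX Y a j q ⊆ (tcubeSys 4 ((θ.ℓ₆ + 1) ^ ((lamF k v).k - j) * ((θ.ℓ₆ + 1) * ((lamF k v).n + 1)))).above q)
    (hSX' : ∀ k v, v ∈ FlowStep.Box γ₀ k → ∀ Y a j q,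
      (lamF k v).SX' Y a j q ⊆ (tcubeSys 4 ((θ.ℓ₆ + 1) ^ ((lamF k v).k - j) * ((θ.ℓ₆ + 1) * ((lamF k v).n + 1)))).above q)
    (hX0 : ∀ k v, v ∈ FlowStep.Box γ₀ k → ∀ Y, ∀ a ∈ (lamF k v).Sc Y, ∀ j ∈ Finset.range ((lamF k v).k + 1), ∀ q ∈ (lamF k v).Sq' Y a j,
      ∀ x ∈ (lamF k v).SX' Y a j q, x.1.image (tcoarse ((θ.ℓ₆ + 1) ^ ((lamF k v).k - j)) ((θ.ℓ₆ + 1) * ((lamF k v).n + 1))) ⊆ Y.1)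
    -- (1) LEMMA 1: per-term analyticity on (1.34), every member in the box
    (hAnT : ∀ k v, v ∈ FlowStep.Box γ₀ k → ∀ Y, ∀ a ∈ (lamF k v).S0 Y, ∀ X ∈ ((lamF k v).F Y a).powerset, ∀ j ∈ Finset.range ((lamF k v).k + 1),
      ∀ q ∈ (lamF k v).Sq Y a j, ∀ x ∈ (lamF k v).SX Y a j q, AnalyticOnNhd ℂ ((lamF k v).T Y a X j q x) ((lamF k v).sp1 Y))
    (hAnT' : ∀ k v, v ∈ FlowStep.Box γ₀ k → ∀ Y, ∀ a ∈ (lamF k v).Sc Y, ∀ j ∈ Finset.range ((lamF k v).k + 1), ∀ q ∈ (lamF k v).Sq' Y a j,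
      ∀ x ∈ (lamF k v).SX' Y a j q, AnalyticOnNhd ℂ ((lamF k v).T' Y a j q x) ((lamF k v).sp1 Y))
    -- (1) LEMMA 1: the k-UNIFORM thresholds and restrictions on the ONE residual letter record `c₀`
    (hK : 0 ≤ K) (hK' : 0 ≤ K') (hκ : 0 ≤ c₀.κ) (hδ1 : c₀.δ < 1) (hδκ : 1 ≤ c₀.δ * c₀.κ)
    (hκ126 : kappa₀ 64 8 ≤ c₀.κ) (hκ126' : kappa₀ 64 8 ≤ c₀.δ * c₀.κ)
    (hκ₁ : 1 + 2 * Real.log (8 * 12 ^ 3) ≤ c₀.κ₁) (hκ₁' : 2 + 16 * Real.log 128 ≤ c₀.κ₁)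
    (hδ₀M : 10 * Real.exp (-1) ≤ c₀.δ₀ * c₀.M) (hδ₀M5 : 2 * Real.log 5 ≤ c₀.δ₀ * c₀.M)
    (hR8 : (1 - c₀.δ) * c₀.κ ≤ (1 / 4) * (c₀.κ₁ - 1)) (hR9 : (1 - 2 * c₀.δ) * c₀.κ ≤ (1 / 16) * c₀.κ₁)
    -- (1) LEMMA 1: per-term (1.24), (1.30) by reference to [I] (3.54), (3.17), [15] Prop. 4, [13] (3.108), every member in the box; k-UNIFORM `K, K′`, headroom (1 − ϑ)
    (h124 : ∀ k v, v ∈ FlowStep.Box γ₀ k → ∀ Y φ, φ ∈ (lamF k v).sp1 Y → ∀ a ∈ (lamF k v).S0 Y, ∀ X ∈ ((lamF k v).F Y a).powerset,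
      ∀ j ∈ Finset.range ((lamF k v).k + 1), ∀ q ∈ (lamF k v).Sq Y a j, ∀ x ∈ (lamF k v).SX Y a j q,
        ‖(lamF k v).T Y a X j q x φ‖ ≤ K * (((θ.ℓ₆ + 1 : ℕ) : ℝ) ^ j * (((θ.ℓ₆ + 1 : ℕ) : ℝ) ^ (lamF k v).k)⁻¹) ^ 5 *
          Real.exp (-(c₀.κ₁ - 1) *
            (((Y.1 \ (pbox (fun i => natLift a i - (5 : ℕ)) (fun i => natLift a i + 1 + (5 : ℕ))).image
              (proj ((θ.ℓ₆ + 1) * ((lamF k v).n + 1)))).card : ℝ) + X.card)) *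
          Real.exp (-(c₀.κ * torusTreeLen x.1)))
    (h130 : ∀ k v, v ∈ FlowStep.Box γ₀ k → ∀ Y φ, φ ∈ (lamF k v).sp1 Y → ∀ a ∈ (lamF k v).Sc Y, ∀ j ∈ Finset.range ((lamF k v).k + 1),
      ∀ q ∈ (lamF k v).Sq' Y a j, ∀ x ∈ (lamF k v).SX' Y a j q,
        ‖(lamF k v).T' Y a j q x φ‖ ≤ K' * Real.exp (-(1 / 2) * (c₀.δ₀ * c₀.M) * (((θ.ℓ₆ + 1 : ℕ) : ℝ) ^ j * (((θ.ℓ₆ + 1 : ℕ) : ℝ) ^ (lamF k v).k)⁻¹)⁻¹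
            - (1 / 2) * c₀.δ₀ * dist k v Y a j q) *
          Real.exp (-(c₀.κ₁ - 1) * ((Y.1 \ x.1.image (tcoarse ((θ.ℓ₆ + 1) ^ ((lamF k v).k - j)) ((θ.ℓ₆ + 1) * ((lamF k v).n + 1)))).card : ℝ)) *
          Real.exp (-(c₀.κ * torusTreeLen x.1)))
    {ϑ : ℝ} (hϑ0 : 0 ≤ ϑ) (hϑ1 : ϑ < 1)
    (hC : K * K₀ 64 8 * (2 * (6 * ((θ.ℓ₆ + 1 : ℕ) : ℝ)) ^ 4) * Real.exp 1 * Real.exp ((1 / 8) * c₀.κ₁ * (12 ^ 4 - 1)) +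
        2 * (64 * K') * K₀ 64 8 * 1344 ≤
      (1 - ϑ) * (c₀.E₀ * c₀.ε₁ * c₀.C₁ * c₀.M ^ c₀.q * Real.exp (c₀.C₂ * c₀.κ₁)))
    -- (2) LEMMA 2 (pp. 10–11): the curvature terms and the plaquette data of every member in the box; k-UNIFORM `ϑ, R, K₂, m₂`
    (hGlAn : ∀ k v, v ∈ FlowStep.Box γ₀ k → ∀ Y, AnalyticOnNhd ℂ ((lamF k v).Gl Y) ((lamF k v).sp1 Y))
    (hGl : ∀ k v, v ∈ FlowStep.Box γ₀ k → ∀ Y φ, φ ∈ (lamF k v).sp1 Y →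
      ‖(lamF k v).Gl Y φ‖ ≤ ϑ * (c₀.E₀ * c₀.ε₁ * c₀.C₁ * c₀.M ^ c₀.q * Real.exp (c₀.C₂ * c₀.κ₁)) *
        Real.exp (-((1 - 2 * c₀.δ) * c₀.κ * (tsys 4 ((θ.ℓ₆ + 1) * ((lamF k v).n + 1))).dj Y)))
    (he : ∀ k v, v ∈ FlowStep.Box γ₀ k → ∀ Y b, ‖(lamF k v).e Y b‖ ≤ 1)
    {R K₂ : ℝ} {m₂ : ℕ} (hK₂ : 0 ≤ K₂) (hR : 0 < R) (hε3 : 3 * c₀.ε₁ ≤ R)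
    (hW : ∀ k v, v ∈ FlowStep.Box γ₀ k → ∀ Y, ∀ i ∈ (lamF k v).s Y, ∀ φ ∈ (lamF k v).sp1 Y, AnalyticOnNhd ℂ ((lamF k v).Wf Y i φ) (ball 0 R))
    (hKW : ∀ k v, v ∈ FlowStep.Box γ₀ k → ∀ Y, ∀ i ∈ (lamF k v).s Y, ∀ φ ∈ (lamF k v).sp1 Y, ∀ z ∈ ball (0 : (lamF k v).E) R,
      ‖(lamF k v).Wf Y i φ z‖ ≤ K₂ * Real.exp (-(c₀.κ₁ - 1) * ((Y.1.card : ℝ) - 1)) * ‖z‖ ^ 3)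
    (hcard : ∀ k v, v ∈ FlowStep.Box γ₀ k → ∀ Y, ((lamF k v).s Y).card ≤ m₂ * Y.1.card)
    (hsp : ∀ k v, v ∈ FlowStep.Box γ₀ k → ∀ Y φ, φ ∈ (lamF k v).sp1 Y → ‖(lamF k v).g‖ * ‖(lamF k v).rd Y φ‖ < c₀.ε₁)
    (hfloor : 27 * m₂ * K₂ * Real.exp (c₀.κ₁ - 1) ≤ c₀.C₃ * c₀.M ^ 4 * Real.exp (c₀.C₂ * c₀.κ₁))
    (hAnP : ∀ k v, v ∈ FlowStep.Box γ₀ k → ∀ Y, ∀ i ∈ (lamF k v).s Y,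
      AnalyticOnNhd ℂ (fun φ => scaled (lamF k v).g ((lamF k v).Wf Y i φ) ((lamF k v).rd Y φ)) ((lamF k v).sp1 Y))
    (hG : ∀ k v, v ∈ FlowStep.Box γ₀ k → ∀ Y, (lamF k v).GaugeInv ((lamF k v).V Y) ∧
      (lamF k v).GaugeInv ((WtOfRecord θ (lamF k v)).toStepData.quadForm Y) ∧ (lamF k v).GaugeInv ((lamF k v).Vpp Y))
    -- (3) LEMMA 3 (p. 20): THE LOCATED FLAG, member-wise — NODE A's content, displayed
    (h3 : ∀ k v, v ∈ FlowStep.Box γ₀ k →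
      B13.Lemma3Printed (WtOfRecord θ (lamF k v)).toStepData ({ c₀ with L := θ.ℓ₆ + 1 } : B13.Consts)) :
    B13FamLeafOfRecord θ γ₀ lamF { c₀ with L := θ.ℓ₆ + 1 } := by
  refine b13FamLeafOfRecord_of_forall_b13LeafOfRecord (fun k v hv => ?_) (fun k v hv => ?_)
  · simp only [c13OfRecord, hc k v hv]
  · have hcv := hc k v hv
    subst hcv
    exact b13LeafOfRecord_of_located θ (lamF k v) (hN12 k v hv) (dist k v) (hS0Y k v hv) (hFsub k v hv) (hSq k v hv) (hScY k v hv)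
      (hdist0 k v hv) (hdist k v hv) (hSX k v hv) (hSX' k v hv) (hX0 k v hv) (hAnT k v hv) (hAnT' k v hv) hK hK' hκ hδ1 hδκ hκ126 hκ126'
      hκ₁ hκ₁' hδ₀M hδ₀M5 hR8 hR9 (h124 k v hv) (h130 k v hv) hϑ0 hϑ1 hC (hGlAn k v hv) (hGl k v hv) (he k v hv) (hidx.g_ne_zero hv) hK₂ hR hε3
      (hW k v hv) (hKW k v hv) (hcard k v hv) (hsp k v hv) hfloor (hAnP k v hv) (hG k v hv) (h3 k v hv)

set_option maxSynthPendingDepth 3 in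
/-- **THE [B13] FAMILY LEAF AT NODE 00's GROUP OF RECORD AT LEVEL T — ALL THREE LEMMAS MEMBER-WISE FROM LOCATED INPUTS, NO FLAG; LEMMA 3 AT THE NATURAL RATE
WITH ONE NUMERICS BUNDLE.**  The Lemma 1–2 inputs of `b13FamLeafOfRecord_of_located` and, for LEMMA 3 (pp. 14–20) at LEVEL T: for every member in the box,
(2.26) PER TERM of H(Z) = Σ_{(𝐃,P)} T₃ (`h226`: the (2.26)-majorant of every term of (2.9)∕(2.14) — NODE A's content in the termwise currency, where [13] Thm 3.10∕3.12
enter) AT THE NATURAL |P|-RATE `a(k, v) = γ₂ε₁²∕g_k²`, `g_k = v (Fin.last k)` (p. 17); ONE bundle `hN` of print's restrictions on the constants at ℓ = ½L at the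
BOX-MINIMAL rate `γ₂ε₁²∕γ₀²` (p. 18: «Assuming (1∕20)γ₂ε₁²∕g_k² ≧ (1∕20)γ₂ε₁²∕γ² ≧ 4κ» — the one history-dependent letter, ANTITONE:
`B13NodeTorusFamily.rate_min_le_rate` + `B13Lemma3TorusSocket.termwise226_anti` by name; `0 ≤ γ₂`); the displayed bond-fineness law `(lamF k v).m₃ = m₃` (print's
(2.3) fineness is one choice); `8 ≤ L = θ.ℓ₆ + 1`.  Termwise domination of every member's H IS the theorem `termDomination_WtOfRecord` (H is the sum of its terms at
the group of record — discharged inside `b13LeafOfRecord_of_located_termwise`), `hLc` is `rfl`.  CONCLUSION: `B13FamLeafOfRecord θ γ₀ lamF {c₀ with L := θ.ℓ₆ + 1}`.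
((2.38) per member instead: feed `b13FamLeafOfRecord_of_located` with `h3 k v hv := B13Lemma3Torus.lemma3Printed_torus _ _ (h238 k v hv)`.)  Count-neutral:
hypotheses about the HIDDEN family. [cite: Balaban1988RG2Cluster, Lemma 1 p.9, Lemma 2 p.11, Lemma 3 p.20, (2.26) p.17, p.18 (after (2.32)), (2.38) p.20; Balaban1987RG1, Thm 3 p.264] -/
theorem b13FamLeafOfRecord_of_located_termwise
    (hc : ∀ k v, v ∈ FlowStep.Box γ₀ k → (lamF k v).c = c₀) (hidx : ResidB13Fam.IsStepIndexed γ₀ lamF)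
    (hN12 : ∀ k v, v ∈ FlowStep.Box γ₀ k → 12 ≤ (θ.ℓ₆ + 1) * ((lamF k v).n + 1))
    -- (1) LEMMA 1: [I]'s block geometry of the (1.33) index families of every member in the box
    (dist : (k : ℕ) → (v : Fin (k + 1) → ℝ) → TDom 4 ((θ.ℓ₆ + 1) * ((lamF k v).n + 1)) → TPt 4 ((θ.ℓ₆ + 1) * ((lamF k v).n + 1)) → (j : ℕ) →
      TPt 4 ((θ.ℓ₆ + 1) ^ ((lamF k v).k - j) * ((θ.ℓ₆ + 1) * ((lamF k v).n + 1))) → ℝ) {K K' : ℝ}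
    (hS0Y : ∀ k v, v ∈ FlowStep.Box γ₀ k → ∀ Y, ∀ a ∈ (lamF k v).S0 Y,
      (pbox (fun i => natLift a i - (5 : ℕ)) (fun i => natLift a i + 1 + (5 : ℕ))).image (proj ((θ.ℓ₆ + 1) * ((lamF k v).n + 1))) ⊆ Y.1)
    (hFsub : ∀ k v, v ∈ FlowStep.Box γ₀ k → ∀ Y a, (lamF k v).F Y a ⊆
      (pbox (fun i => natLift a i - (5 : ℕ)) (fun i => natLift a i + 1 + (5 : ℕ))).image (proj ((θ.ℓ₆ + 1) * ((lamF k v).n + 1))) \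
        (pbox (fun i => natLift a i - (4 : ℕ)) (fun i => natLift a i + 1 + (4 : ℕ))).image (proj ((θ.ℓ₆ + 1) * ((lamF k v).n + 1))))
    (hSq : ∀ k v, v ∈ FlowStep.Box γ₀ k → ∀ Y, ∀ a ∈ (lamF k v).S0 Y, ∀ j, (lamF k v).Sq Y a j ⊆
      (Finset.univ : Finset (TPt 4 ((θ.ℓ₆ + 1) ^ ((lamF k v).k - j) * ((θ.ℓ₆ + 1) * ((lamF k v).n + 1))))).filter
        (fun q => tcoarse ((θ.ℓ₆ + 1) ^ ((lamF k v).k - j)) ((θ.ℓ₆ + 1) * ((lamF k v).n + 1)) q ∈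
          (pbox (fun i => natLift a i - (2 : ℕ)) (fun i => natLift a i + 1 + (2 : ℕ))).image (proj ((θ.ℓ₆ + 1) * ((lamF k v).n + 1)))))
    (hScY : ∀ k v, v ∈ FlowStep.Box γ₀ k → ∀ Y, (lamF k v).Sc Y ⊆ Y.1)
    (hdist0 : ∀ k v, v ∈ FlowStep.Box γ₀ k → ∀ Y a j q, 0 ≤ c₀.δ₀ * dist k v Y a j q)
    (hdist : ∀ k v, v ∈ FlowStep.Box γ₀ k → ∀ Y a j (n : ℕ) q,
      q ∉ (pbox (fun i => (((θ.ℓ₆ + 1) ^ ((lamF k v).k - j) : ℕ) : ℤ) * natLift a i - (n + 1 : ℕ))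
        (fun i => (((θ.ℓ₆ + 1) ^ ((lamF k v).k - j) : ℕ) : ℤ) * natLift a i + 2 * (((θ.ℓ₆ + 1) ^ ((lamF k v).k - j) : ℕ) : ℤ) - 1 + (n + 1 : ℕ))).image
          (proj ((θ.ℓ₆ + 1) ^ ((lamF k v).k - j) * ((θ.ℓ₆ + 1) * ((lamF k v).n + 1)))) →
        c₀.δ₀ * c₀.M * ((n : ℝ) + 1) ≤ c₀.δ₀ * dist k v Y a j q)
    (hSX : ∀ k v, v ∈ FlowStep.Box γ₀ k → ∀ Y a j q,
      (lamF k v).SX Y a j q ⊆ (tcubeSys 4 ((θ.ℓ₆ + 1) ^ ((lamF k v).k - j) * ((θ.ℓ₆ + 1) * ((lamF k v).n + 1)))).above q)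
    (hSX' : ∀ k v, v ∈ FlowStep.Box γ₀ k → ∀ Y a j q,
      (lamF k v).SX' Y a j q ⊆ (tcubeSys 4 ((θ.ℓ₆ + 1) ^ ((lamF k v).k - j) * ((θ.ℓ₆ + 1) * ((lamF k v).n + 1)))).above q)
    (hX0 : ∀ k v, v ∈ FlowStep.Box γ₀ k → ∀ Y, ∀ a ∈ (lamF k v).Sc Y, ∀ j ∈ Finset.range ((lamF k v).k + 1), ∀ q ∈ (lamF k v).Sq' Y a j,
      ∀ x ∈ (lamF k v).SX' Y a j q, x.1.image (tcoarse ((θ.ℓ₆ + 1) ^ ((lamF k v).k - j)) ((θ.ℓ₆ + 1) * ((lamF k v).n + 1))) ⊆ Y.1)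
    -- (1) LEMMA 1: per-term analyticity on (1.34), every member in the box
    (hAnT : ∀ k v, v ∈ FlowStep.Box γ₀ k → ∀ Y, ∀ a ∈ (lamF k v).S0 Y, ∀ X ∈ ((lamF k v).F Y a).powerset, ∀ j ∈ Finset.range ((lamF k v).k + 1),
      ∀ q ∈ (lamF k v).Sq Y a j, ∀ x ∈ (lamF k v).SX Y a j q, AnalyticOnNhd ℂ ((lamF k v).T Y a X j q x) ((lamF k v).sp1 Y))
    (hAnT' : ∀ k v, v ∈ FlowStep.Box γ₀ k → ∀ Y, ∀ a ∈ (lamF k v).Sc Y, ∀ j ∈ Finset.range ((lamF k v).k + 1), ∀ q ∈ (lamF k v).Sq' Y a j,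
      ∀ x ∈ (lamF k v).SX' Y a j q, AnalyticOnNhd ℂ ((lamF k v).T' Y a j q x) ((lamF k v).sp1 Y))
    -- (1) LEMMA 1: the k-UNIFORM thresholds and restrictions on the ONE residual letter record `c₀`
    (hK : 0 ≤ K) (hK' : 0 ≤ K') (hκ : 0 ≤ c₀.κ) (hδ1 : c₀.δ < 1) (hδκ : 1 ≤ c₀.δ * c₀.κ)
    (hκ126 : kappa₀ 64 8 ≤ c₀.κ) (hκ126' : kappa₀ 64 8 ≤ c₀.δ * c₀.κ)
    (hκ₁ : 1 + 2 * Real.log (8 * 12 ^ 3) ≤ c₀.κ₁) (hκ₁' : 2 + 16 * Real.log 128 ≤ c₀.κ₁)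
    (hδ₀M : 10 * Real.exp (-1) ≤ c₀.δ₀ * c₀.M) (hδ₀M5 : 2 * Real.log 5 ≤ c₀.δ₀ * c₀.M)
    (hR8 : (1 - c₀.δ) * c₀.κ ≤ (1 / 4) * (c₀.κ₁ - 1)) (hR9 : (1 - 2 * c₀.δ) * c₀.κ ≤ (1 / 16) * c₀.κ₁)
    -- (1) LEMMA 1: per-term (1.24), (1.30) by reference to [I] (3.54), (3.17), [15] Prop. 4, [13] (3.108), every member in the box; k-UNIFORM `K, K′`, headroom (1 − ϑ)
    (h124 : ∀ k v, v ∈ FlowStep.Box γ₀ k → ∀ Y φ, φ ∈ (lamF k v).sp1 Y → ∀ a ∈ (lamF k v).S0 Y, ∀ X ∈ ((lamF k v).F Y a).powerset,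
      ∀ j ∈ Finset.range ((lamF k v).k + 1), ∀ q ∈ (lamF k v).Sq Y a j, ∀ x ∈ (lamF k v).SX Y a j q,
        ‖(lamF k v).T Y a X j q x φ‖ ≤ K * (((θ.ℓ₆ + 1 : ℕ) : ℝ) ^ j * (((θ.ℓ₆ + 1 : ℕ) : ℝ) ^ (lamF k v).k)⁻¹) ^ 5 *
          Real.exp (-(c₀.κ₁ - 1) *
            (((Y.1 \ (pbox (fun i => natLift a i - (5 : ℕ)) (fun i => natLift a i + 1 + (5 : ℕ))).image
              (proj ((θ.ℓ₆ + 1) * ((lamF k v).n + 1)))).card : ℝ) + X.card)) *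
          Real.exp (-(c₀.κ * torusTreeLen x.1)))
    (h130 : ∀ k v, v ∈ FlowStep.Box γ₀ k → ∀ Y φ, φ ∈ (lamF k v).sp1 Y → ∀ a ∈ (lamF k v).Sc Y, ∀ j ∈ Finset.range ((lamF k v).k + 1),
      ∀ q ∈ (lamF k v).Sq' Y a j, ∀ x ∈ (lamF k v).SX' Y a j q,
        ‖(lamF k v).T' Y a j q x φ‖ ≤ K' * Real.exp (-(1 / 2) * (c₀.δ₀ * c₀.M) * (((θ.ℓ₆ + 1 : ℕ) : ℝ) ^ j * (((θ.ℓ₆ + 1 : ℕ) : ℝ) ^ (lamF k v).k)⁻¹)⁻¹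
            - (1 / 2) * c₀.δ₀ * dist k v Y a j q) *
          Real.exp (-(c₀.κ₁ - 1) * ((Y.1 \ x.1.image (tcoarse ((θ.ℓ₆ + 1) ^ ((lamF k v).k - j)) ((θ.ℓ₆ + 1) * ((lamF k v).n + 1)))).card : ℝ)) *
          Real.exp (-(c₀.κ * torusTreeLen x.1)))
    {ϑ : ℝ} (hϑ0 : 0 ≤ ϑ) (hϑ1 : ϑ < 1)
    (hC : K * K₀ 64 8 * (2 * (6 * ((θ.ℓ₆ + 1 : ℕ) : ℝ)) ^ 4) * Real.exp 1 * Real.exp ((1 / 8) * c₀.κ₁ * (12 ^ 4 - 1)) +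
        2 * (64 * K') * K₀ 64 8 * 1344 ≤
      (1 - ϑ) * (c₀.E₀ * c₀.ε₁ * c₀.C₁ * c₀.M ^ c₀.q * Real.exp (c₀.C₂ * c₀.κ₁)))
    -- (2) LEMMA 2 (pp. 10–11): the curvature terms and the plaquette data of every member in the box; k-UNIFORM `ϑ, R, K₂, m₂`
    (hGlAn : ∀ k v, v ∈ FlowStep.Box γ₀ k → ∀ Y, AnalyticOnNhd ℂ ((lamF k v).Gl Y) ((lamF k v).sp1 Y))
    (hGl : ∀ k v, v ∈ FlowStep.Box γ₀ k → ∀ Y φ, φ ∈ (lamF k v).sp1 Y →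
      ‖(lamF k v).Gl Y φ‖ ≤ ϑ * (c₀.E₀ * c₀.ε₁ * c₀.C₁ * c₀.M ^ c₀.q * Real.exp (c₀.C₂ * c₀.κ₁)) *
        Real.exp (-((1 - 2 * c₀.δ) * c₀.κ * (tsys 4 ((θ.ℓ₆ + 1) * ((lamF k v).n + 1))).dj Y)))
    (he : ∀ k v, v ∈ FlowStep.Box γ₀ k → ∀ Y b, ‖(lamF k v).e Y b‖ ≤ 1)
    {R K₂ : ℝ} {m₂ : ℕ} (hK₂ : 0 ≤ K₂) (hR : 0 < R) (hε3 : 3 * c₀.ε₁ ≤ R)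
    (hW : ∀ k v, v ∈ FlowStep.Box γ₀ k → ∀ Y, ∀ i ∈ (lamF k v).s Y, ∀ φ ∈ (lamF k v).sp1 Y, AnalyticOnNhd ℂ ((lamF k v).Wf Y i φ) (ball 0 R))
    (hKW : ∀ k v, v ∈ FlowStep.Box γ₀ k → ∀ Y, ∀ i ∈ (lamF k v).s Y, ∀ φ ∈ (lamF k v).sp1 Y, ∀ z ∈ ball (0 : (lamF k v).E) R,
      ‖(lamF k v).Wf Y i φ z‖ ≤ K₂ * Real.exp (-(c₀.κ₁ - 1) * ((Y.1.card : ℝ) - 1)) * ‖z‖ ^ 3)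
    (hcard : ∀ k v, v ∈ FlowStep.Box γ₀ k → ∀ Y, ((lamF k v).s Y).card ≤ m₂ * Y.1.card)
    (hsp : ∀ k v, v ∈ FlowStep.Box γ₀ k → ∀ Y φ, φ ∈ (lamF k v).sp1 Y → ‖(lamF k v).g‖ * ‖(lamF k v).rd Y φ‖ < c₀.ε₁)
    (hfloor : 27 * m₂ * K₂ * Real.exp (c₀.κ₁ - 1) ≤ c₀.C₃ * c₀.M ^ 4 * Real.exp (c₀.C₂ * c₀.κ₁))
    (hAnP : ∀ k v, v ∈ FlowStep.Box γ₀ k → ∀ Y, ∀ i ∈ (lamF k v).s Y,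
      AnalyticOnNhd ℂ (fun φ => scaled (lamF k v).g ((lamF k v).Wf Y i φ) ((lamF k v).rd Y φ)) ((lamF k v).sp1 Y))
    (hG : ∀ k v, v ∈ FlowStep.Box γ₀ k → ∀ Y, (lamF k v).GaugeInv ((lamF k v).V Y) ∧
      (lamF k v).GaugeInv ((WtOfRecord θ (lamF k v)).toStepData.quadForm Y) ∧ (lamF k v).GaugeInv ((lamF k v).Vpp Y))
    -- (3) LEMMA 3 (pp. 14–20) at LEVEL T: (2.26) per term per member at the natural rate; ONE numerics bundle at the box-minimal rate; the fineness law; 8 ≤ L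
    (hL8 : 8 ≤ θ.ℓ₆ + 1) (hγ₂ : 0 ≤ c₀.γ₂) {m₃ : ℕ} (hm₃ : ∀ k v, v ∈ FlowStep.Box γ₀ k → (lamF k v).m₃ = m₃) {a₂ a₂' a₅ Aabs : ℝ}
    (h226 : ∀ k v, v ∈ FlowStep.Box γ₀ k →
      Termwise226 ({ c₀ with L := θ.ℓ₆ + 1 } : B13.Consts) (c₀.γ₂ * c₀.ε₁ ^ 2 / (v (Fin.last k)) ^ 2) a₅ (WtOfRecord θ (lamF k v)) (lamF k v).T₃)
    (hN : Lemma3Numerics ({ c₀ with L := θ.ℓ₆ + 1 } : B13.Consts) (m₃ + 1) (((θ.ℓ₆ + 1 : ℕ) : ℝ) / 2) (c₀.γ₂ * c₀.ε₁ ^ 2 / γ₀ ^ 2) a₂ a₂' a₅ Aabs) :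
    B13FamLeafOfRecord θ γ₀ lamF { c₀ with L := θ.ℓ₆ + 1 } := by
  refine b13FamLeafOfRecord_of_forall_b13LeafOfRecord (fun k v hv => ?_) (fun k v hv => ?_)
  · simp only [c13OfRecord, hc k v hv]
  · -- (2.26) at the box-minimal rate (antitone in the rate) and the numerics at the member's bond fineness
    have hA : 0 ≤ ({ c₀ with L := θ.ℓ₆ + 1 } : B13.Consts).α₆ * ({ c₀ with L := θ.ℓ₆ + 1 } : B13.Consts).eps2 :=
      mul_nonneg hN.hα₆.le hN.hε₀
    have h226₀ := termwise226_anti ({ c₀ with L := θ.ℓ₆ + 1 } : B13.Consts) hA (rate_min_le_rate (ε₁ := c₀.ε₁) hγ₂ hv)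
      (WtOfRecord θ (lamF k v)) (lamF k v).T₃ (h226 k v hv)
    have hN' : Lemma3Numerics ({ c₀ with L := θ.ℓ₆ + 1 } : B13.Consts) ((lamF k v).m₃ + 1) (((θ.ℓ₆ + 1 : ℕ) : ℝ) / 2)
        (c₀.γ₂ * c₀.ε₁ ^ 2 / γ₀ ^ 2) a₂ a₂' a₅ Aabs := by
      rw [hm₃ k v hv]; exact hN
    have hcv := hc k v hv
    subst hcv
    exact b13LeafOfRecord_of_located_termwise θ (lamF k v) (hN12 k v hv) (dist k v) (hS0Y k v hv) (hFsub k v hv) (hSq k v hv) (hScY k v hv)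
      (hdist0 k v hv) (hdist k v hv) (hSX k v hv) (hSX' k v hv) (hX0 k v hv) (hAnT k v hv) (hAnT' k v hv) hK hK' hκ hδ1 hδκ hκ126 hκ126'
      hκ₁ hκ₁' hδ₀M hδ₀M5 hR8 hR9 (h124 k v hv) (h130 k v hv) hϑ0 hϑ1 hC (hGlAn k v hv) (hGl k v hv) (he k v hv) (hidx.g_ne_zero hv) hK₂ hR hε3
      (hW k v hv) (hKW k v hv) (hcard k v hv) (hsp k v hv) hfloor (hAnP k v hv) (hG k v hv) hL8 h226₀ hN'

end Family

end Summit.QuantumFields.YangMills.BalabanUVNodes.N10AtRecord11B13Family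

end
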